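/-
Copyright (c) 2026 the pub-hodgecm-mathlib formalisation cell (harness21).  Prover seat hodgecm-mathlib-F0P2-p11 (g2) (L1; LEAD F0P6-plan (g14) «(o1) KIND 1», memo
`CENSUS-K1-DealTable` ADDENDUM 2 route (c)+(c″) ASSEMBLED), Track B «K2-LIT» ∕ hLiu418 #184♮, ROAD Φ, G5-b: THE TRANSLATE REDUCTION behind the middle Weyl element —
`f(w₀ · u · Λ b · y) = σ(w₀ Λ b w₀) · f(w₀ · u' · y)` for upper-triangular `b` and any unipotent `u'` with the conjugated corner coordinate.  THEOREMS ONLY.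
-/
import Summits.HodgeConjecture.HodgeConjecture.Theorems.K2LiuReflStdConjLeviUpper   -- ★ p862844 `apply_reflStd_levi_upper`
import Summits.HodgeConjecture.HodgeConjecture.Theorems.K2LiuReflStdUnipCongr       -- ★ p862866 `apply_reflStd_unip_congr`
import Summits.HodgeConjecture.HodgeConjecture.Theorems.K2LiuSiegelLeviConjUnipDeltaChar   -- ★ `conj_mem_unipDelta`
import HarnessLib

/-!
# Crux `HLiu418`, KIND 1, (K1b-W) route (c)+(c″): the translate reduction `f(w₀ · u · Λ b · y) = σ(w₀ Λb w₀) · f(w₀ · u' · y)`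

Cell `hodgecm-mathlib`, crux item hLiu418 = `stmt-HodgeConjecture-24832` (helper lane, count-neutral); squad K2 ∕ K2Liu, LEAD F0P6-plan (g14); prover F0P2-p11 (g2).
THEOREMS ONLY (no `def`, no `instance`, no notation, no named-fact hypothesis, no `sorry`).

In the K1-b♮ line term (★ p862785) the integrand is `f_s (w₀ · n₂ t · g)` with a translate `g = Λ(ĝ m₀)·k` (Iwasawa); after the `GL₂(𝔸_L)`-Iwasawa `ĝ m₀ = b · k₂` (`b` upper
triangular) the Levi part exits: `n₂ t · Λ b = Λ b · (Λb⁻¹ n₂ t Λb)` (`P_Δ` normalises `N_Δ`, ★ `conj_mem_unipDelta`), `Λ b` passes `w₀` as the scalar `σ(w₀Λbw₀)` (★ p862844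
`apply_reflStd_levi_upper`), and the conjugated unipotent may be replaced by ANY unipotent with the same corner coordinate (★ p862866 `apply_reflStd_unip_congr`), e.g. the
rescaled corner line `n₂ (N(b₁₁)⁻¹ t)` (corner coordinate ★ `deltaBlock_mul_toBlocks₁₂_conj`).  HEAD **`apply_reflStd_unip_levi_upper`**.
HONEST LABEL.  Count-neutral helper; `HC_CM` is proved only modulo the 7 printed citations (2 remaining named inputs: hLiu418 = `stmt-HodgeConjecture-24832`,
h413 = `stmt-HodgeConjecture-24833`) until rung 0 closes.

## References
* [MoeglinWaldspurger1995] C. Mœglin, J.-L. Waldspurger, CUP (1995), II.1.7.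
* [KudlaRallis1994] S. Kudla, S. Rallis, Ann. of Math. 140 (1994), §2 (2.10)–(2.12).
-/

set_option autoImplicit false
set_option linter.dupNamespace false -- the mandated namespace repeats `HodgeConjecture.HodgeConjecture`

noncomputable section

open scoped Matrix
open NumberField IsDedekindDomain
open Literature.NumberTheory.Automorphic Literature.NumberTheory.Automorphic.UnitaryGroup Literature.NumberTheory.GaloisRepresentations
open Literature.NumberTheory.GelbartRogawski1991 Literature.NumberTheory.GelbartRogawski1991.GRConstruction
open Literature.NumberTheory.GelbartRogawski1991.AdaptedBlocks
open Literature.NumberTheory.K2Lit.SiegelDoubled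
open UnitaryDualPair

namespace Summit.HodgeConjecture.HodgeConjecture.Cruxes.HLiu418.K2LiuReflStdTranslateReduction

open K2LiuSiegelUnipotentFourierDefs K2LiuSiegelRationalLeviDecomposition K2LiuSiegelLeviConjUnipDeltaChar K2LiuReflStdConjLeviUpper K2LiuReflStdUnipCongr

variable (L : Type) [Field L] [NumberField L] [IsCMField L]
variable {N M : ℕ} (e : Fin N × Fin M ≃ Fin 2)
  (dV : Fin N → L) (hdV : ∀ i, IsCMField.complexConj L (dV i) = dV i)
  (dW : Fin M → L) (hdW : ∀ i, IsCMField.complexConj L (dW i) = dW i)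

variable {g₀ : UnitaryGroup.rationalPair (Fp L) L (IsCMField.complexConj L) N M (Matrix.diagonal dV) (Matrix.diagonal dW)}
  (hg₀ : ((g₀ : GL (Fin N × Fin M) L) : Matrix (Fin N × Fin M) (Fin N × Fin M) L) = Matrix.diagonal (fun k => 1 - 2 * (![0, 1] : Fin 2 → L) (e k)))
  (Λ : GL (Fin 2) (AdeleRing (𝓞 L) L) →* HA L e dV hdV dW hdW)
  (hΛ : ∀ g : GL (Fin 2) (AdeleRing (𝓞 L) L), blk L e dV hdV dW hdW (Λ g) =
    cayR (AdeleRing (𝓞 L) L) (Fin 2) * Matrix.fromBlocks (g : Matrix (Fin 2) (Fin 2) (AdeleRing (𝓞 L) L)) 0 0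
      (((gramR L e dV hdV dW hdW).map ((algebraMap L (AdeleRing (𝓞 L) L)).comp (algebraMap (Fp L) L)))⁻¹ *
        (((g⁻¹ : GL (Fin 2) (AdeleRing (𝓞 L) L)) : Matrix (Fin 2) (Fin 2) (AdeleRing (𝓞 L) L)).map
          (conjAdele (Fp L) L (IsCMField.complexConj L)))ᵀ *
        (gramR L e dV hdV dW hdW).map ((algebraMap L (AdeleRing (𝓞 L) L)).comp (algebraMap (Fp L) L))) *
      cayRinv (AdeleRing (𝓞 L) L) (Fin 2))

include hg₀ hΛ in
/-- **THE TRANSLATE REDUCTION**: `u ∈ N_Δ(𝔸)`, `b ∈ GL₂(𝔸_L)` upper triangular (`b₁₀ = 0`), `f ∈ I_Δ(s, χ)`, and `u' ∈ N_Δ(𝔸)` any unipotent with the corner coordinate of the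
conjugate, `X(u')₁₁ = X(Λb⁻¹ u Λb)₁₁`.  THEN `f (w₀ · u · Λ b · y) = σ_{χ,s}(w₀ Λ b w₀) · f (w₀ · u' · y)`. [cite: MoeglinWaldspurger1995, II.1.7] [cite: KudlaRallis1994, §2 (2.10)–(2.12)] -/
theorem apply_reflStd_unip_levi_upper {χ : HeckeCharacter L} {s : ℂ} {f : HA L e dV hdV dW hdW → ℂ} (hf : IsSiegelDeltaSection L e dV hdV dW hdW χ s f)
    {u : HA L e dV hdV dW hdW} (hu : u ∈ unipDelta L e dV hdV dW hdW)
    (b : GL (Fin 2) (AdeleRing (𝓞 L) L)) (hb : (b : Matrix (Fin 2) (Fin 2) (AdeleRing (𝓞 L) L)) 1 0 = 0)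
    {u' : HA L e dV hdV dW hdW} (hu' : u' ∈ unipDelta L e dV hdV dW hdW)
    (h11 : (blk L e dV hdV dW hdW u').toBlocks₁₂ 1 1 = (blk L e dV hdV dW hdW ((Λ b)⁻¹ * u * Λ b)).toBlocks₁₂ 1 1) (y : HA L e dV hdV dW hdW) :
    f (iotaGG L e dV hdV dW hdW (1, UnitaryGroup.rationalPairToAdelic (Fp L) L (IsCMField.complexConj L) N M (Matrix.diagonal dV) (Matrix.diagonal dW) g₀) * u * Λ b * y) =
      siegelDeltaCharacter L e dV hdV dW hdW χ s
          (iotaGG L e dV hdV dW hdW (1, UnitaryGroup.rationalPairToAdelic (Fp L) L (IsCMField.complexConj L) N M (Matrix.diagonal dV) (Matrix.diagonal dW) g₀) * Λ b *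
            iotaGG L e dV hdV dW hdW (1, UnitaryGroup.rationalPairToAdelic (Fp L) L (IsCMField.complexConj L) N M (Matrix.diagonal dV) (Matrix.diagonal dW) g₀)) *
        f (iotaGG L e dV hdV dW hdW (1, UnitaryGroup.rationalPairToAdelic (Fp L) L (IsCMField.complexConj L) N M (Matrix.diagonal dV) (Matrix.diagonal dW) g₀) * u' * y) := by
  have hconj : (Λ b)⁻¹ * u * Λ b ∈ unipDelta L e dV hdV dW hdW := conj_mem_unipDelta L e dV hdV dW hdW (isSiegelDelta_levi_apply L e dV hdV dW hdW Λ hΛ b) hu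
  -- `w₀ · u · Λb · y = w₀ · Λb · ((Λb⁻¹ u Λb) · y)`
  rw [show iotaGG L e dV hdV dW hdW (1, UnitaryGroup.rationalPairToAdelic (Fp L) L (IsCMField.complexConj L) N M (Matrix.diagonal dV) (Matrix.diagonal dW) g₀) * u * Λ b * y =
      iotaGG L e dV hdV dW hdW (1, UnitaryGroup.rationalPairToAdelic (Fp L) L (IsCMField.complexConj L) N M (Matrix.diagonal dV) (Matrix.diagonal dW) g₀) * Λ b *
        ((Λ b)⁻¹ * u * Λ b * y) by group,
    apply_reflStd_levi_upper L e dV hdV dW hdW hg₀ Λ hΛ hf b hb, ← mul_assoc,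
    apply_reflStd_unip_congr L e dV hdV dW hdW hg₀ Λ hΛ hf hconj hu' h11.symm y]

end Summit.HodgeConjecture.HodgeConjecture.Cruxes.HLiu418.K2LiuReflStdTranslateReduction

end
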